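import Summits.QuantumFields.YangMills.Theorems.ColdStartUniversalityLatticeLangevinFiniteDimensionalLaws
import Summits.QuantumFields.YangMills.Theorems.ColdStartUniversalityLatticeLangevinTimeDecorrelation
import Summits.QuantumFields.YangMills.Theorems.ColdStartUniversalityLatticeLangevinWilsonReversibleMeasurable
import HarnessLib

/-!
# Route `ColdStartUniversality` (fixed-cut-off SZZ dynamics): ★★★ CONVERGENCE TO STATIONARITY IN FINITE-DIMENSIONAL DISTRIBUTIONS —
# after a waiting time `s`, the multi-time laws of every strong solution are `Ce^(−cs)`-close to those of the stationary Markov chain of THE kernels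

Helper file (seat `ym-line-csu-p1`, g33; `--supports stmt-QuantumFields-24809`).  The finite-dimensional Markov property (file 47:
`E[Z·f₁(U_(s+t₁))⋯f_n(U_(s+Σtᵢ))] = E[Z·(K_(t₁)f₁⋯K_(t_n)f_n 1)(U_s)]`, `(K_t f h)(y) = ∫ f·h dκ_t(y)`) and the every-start exponential mixing of
THE transition kernels (Harris, `abs_transition_sub_wilson_le_exp`) show that from EVERY deterministic start — in particular the cold start of the
route — the process FORGETS ITS START at the level of all finite-dimensional distributions:
* `abs_foldr_transition_le_one` — `|K_(t₁)f₁⋯K_(t_n)f_n 1| ≤ 1` for `|fᵢ| ≤ 1`;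
* ★★★ `abs_twoTime_sub_stationary_le_exp` — `|E[F(U_s)G(U_(s+t))] − ∫ F·(κ_tG) dμ_(β')| ≤ C·e^(−cs)` (`|F|, |G| ≤ 1`; every `t`);
* ★★★ `abs_foldr_comp_sub_stationary_le_exp` — `|E[f₁(U_(s+t₁))⋯f_n(U_(s+Σtᵢ))] − ∫ (K_(t₁)f₁⋯K_(t_n)f_n 1) dμ_(β')| ≤ C·e^(−cs)` for every list of
  increments/observables with `|fᵢ| ≤ 1` — the f.d.d. of the shifted process `U_(s+·)` converge, uniformly over bounded observables (i.e. in total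
  variation of each finite-dimensional marginal), to those of the STATIONARY chain `μ_(β') ⊗ κ_(t₁) ⊗ κ_(t₂) ⋯`;
* ★ `integral_wilson_transition_foldr_eq` — the stationary f.d.d. are shift-invariant: `∫ κ_u(K_l) dμ_(β') = ∫ K_l dμ_(β')` (invariance of `μ_(β')`,
  SZZ Lemma 3.3 as proved in the tree).
Constants `C, c > 0` depend on `L, β'` (Harris at fixed cut-off; every coupling).  THEOREMS ONLY, no definition (`List.foldr`), no sorry; [folklore].
HONEST FRAMING: fixed cut-off; `UniformColdStartMixing` (24809) is NOT restated; no crux, rung or summit statement is proved; the Yang–Mills mass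
gap is NOT proved.
-/

set_option autoImplicit false

noncomputable section

namespace Summit.QuantumFields.YangMills.Theorems.ColdStartUniversality

open MeasureTheory ProbabilityTheory Filter Topology
open scoped NNReal ENNReal BigOperators
open Literature Literature.Probability.Process Literature.MathematicalPhysics.QuantumFieldTheory
open Literature.MathematicalPhysics.QuantumLattice (fundamentalRep fundamentalLatticeRep continuous_fundamentalRep)

variable {L : ℕ} [NeZero L]

/-! ## §1. The iterated kernel observable of `[-1,1]`-valued observables is `[-1,1]`-valued -/

omit [NeZero L] in
/-- `|K_(t₁)f₁⋯K_(t_n)f_n 1| ≤ 1` when all `|fᵢ| ≤ 1`. [folklore] -/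
theorem abs_foldr_transition_le_one
    (κ : ℝ≥0 → Kernel (GaugeConfig 3 L (Matrix.specialUnitaryGroup (Fin 2) ℂ))
      (GaugeConfig 3 L (Matrix.specialUnitaryGroup (Fin 2) ℂ))) [∀ t, IsMarkovKernel (κ t)] :
    ∀ (l : List (ℝ≥0 × (GaugeConfig 3 L (Matrix.specialUnitaryGroup (Fin 2) ℂ) → ℝ))), (∀ p ∈ l, ∀ z, |p.2 z| ≤ 1) →
      ∀ y, |(l.foldr (fun p acc => fun y => ∫ z, p.2 z * acc z ∂(κ p.1 y))
        (fun _ : GaugeConfig 3 L (Matrix.specialUnitaryGroup (Fin 2) ℂ) => (1 : ℝ))) y| ≤ 1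
  | [], _, y => by simp
  | p :: l, h, y => by
    have ih := abs_foldr_transition_le_one κ l (fun q hq => h q (List.mem_cons_of_mem _ hq))
    have hp : ∀ z, |p.2 z| ≤ 1 := h p List.mem_cons_self
    rw [List.foldr_cons]
    have hh := norm_integral_le_of_norm_le_const (μ := κ p.1 y) (C := 1)
      (f := fun z => p.2 z * (l.foldr (fun p acc => fun y => ∫ z, p.2 z * acc z ∂(κ p.1 y))
        (fun _ : GaugeConfig 3 L (Matrix.specialUnitaryGroup (Fin 2) ℂ) => (1 : ℝ))) z)
      (Eventually.of_forall fun z => by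
        rw [norm_mul, Real.norm_eq_abs, Real.norm_eq_abs]
        exact mul_le_one₀ (hp z) (abs_nonneg _) (ih z))
    simpa [Real.norm_eq_abs] using hh

/-! ## §2. Two-time correlations converge to the stationary ones -/

/-- ★★★ **Two-time correlations forget the start**: there are `C, c > 0` (depending on `L, β'`) such that for every realising kernel family `κ`,
EVERY strong solution `U` from a deterministic start on ANY space, all `s, t` and all bounded measurable `F, G` with `|F|, |G| ≤ 1`,
`|E[F(U_s)·G(U_(s+t))] − ∫ F·(κ_t G) dμ_(β')| ≤ C·e^(−cs)` — the two-time correlation at waiting time `s` is exponentially close to the STATIONARY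
two-time correlation `⟨F, κ_t G⟩_(μ_(β'))`. [folklore] -/
theorem abs_twoTime_sub_stationary_le_exp (L : ℕ) [NeZero L] (β' : ℝ) :
    ∃ C c : ℝ, 0 < C ∧ 0 < c ∧
      ∀ (κ : ℝ≥0 → Kernel (GaugeConfig 3 L (Matrix.specialUnitaryGroup (Fin 2) ℂ))
          (GaugeConfig 3 L (Matrix.specialUnitaryGroup (Fin 2) ℂ))) [∀ t, IsMarkovKernel (κ t)],
        (∀ (t : ℝ≥0) (x : GaugeConfig 3 L (Matrix.specialUnitaryGroup (Fin 2) ℂ))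
          (Ω : Type) [MeasurableSpace Ω] (P : Measure Ω) [IsProbabilityMeasure P]
          (W : ℝ≥0 → Ω → (Edge 3 L × NoiseIdx 2 → ℝ)) (hW : IsFlatBrownian W P)
          (U : ℝ≥0 → Ω → GaugeConfig 3 L (Matrix.specialUnitaryGroup (Fin 2) ℂ)),
          (∀ ω, U 0 ω = x) →
          (latticeLangevinDynamics (fundamentalLatticeRep 2) β').IsSolution (fundamentalRep (Fin 2))
            hW.natFiltration P W U →
          κ t x = P.map (U t)) →
        ∀ (x : GaugeConfig 3 L (Matrix.specialUnitaryGroup (Fin 2) ℂ))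
          (Ω : Type) [MeasurableSpace Ω] (P : Measure Ω) [IsProbabilityMeasure P]
          (W : ℝ≥0 → Ω → (Edge 3 L × NoiseIdx 2 → ℝ)) (hW : IsFlatBrownian W P)
          (U : ℝ≥0 → Ω → GaugeConfig 3 L (Matrix.specialUnitaryGroup (Fin 2) ℂ)),
          (∀ ω, U 0 ω = x) →
          (latticeLangevinDynamics (fundamentalLatticeRep 2) β').IsSolution (fundamentalRep (Fin 2)) hW.natFiltration P W U →
          ∀ (s t : ℝ≥0) (F G : GaugeConfig 3 L (Matrix.specialUnitaryGroup (Fin 2) ℂ) → ℝ),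
            Measurable F → (∀ z, |F z| ≤ 1) → Measurable G → (∀ z, |G z| ≤ 1) →
            |(∫ ω, F (U s ω) * G (U (s + t) ω) ∂P) -
                ∫ y, F y * (∫ z, G z ∂(κ t y)) ∂(wilsonMeasure (d := 3) (L := L) (fundamentalRep (Fin 2)) β')| ≤ C * Real.exp (-c * s) := by
  classical
  obtain ⟨C, c, hC, hc, h⟩ := abs_transition_sub_wilson_le_exp L β'
  refine ⟨C, c, hC, hc, fun κ _ hreal x Ω _ P _ W hW U hU0 hU s t F G hF hF1 hG hG1 => ?_⟩
  -- the observable `H = F · κ_t G`, bounded by `1`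
  have hκGm : Measurable fun y => ∫ z, G z ∂(κ t y) := (hG.stronglyMeasurable.integral_kernel (κ := κ t)).measurable
  have hκGb : ∀ y, |∫ z, G z ∂(κ t y)| ≤ 1 := fun y => by
    have hh := norm_integral_le_of_norm_le_const (μ := κ t y) (f := G) (C := 1)
      (Eventually.of_forall fun z => by simpa [Real.norm_eq_abs] using hG1 z)
    simpa [Real.norm_eq_abs] using hh
  have hHm : Measurable fun y => F y * ∫ z, G z ∂(κ t y) := hF.mul hκGm
  have hHb : ∀ y, |F y * ∫ z, G z ∂(κ t y)| ≤ 1 := fun y => by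
    rw [abs_mul]; exact mul_le_one₀ (hF1 y) (abs_nonneg _) (hκGb y)
  -- `E[F(U_s)G(U_(s+t))] = ∫ H dκ_s(x)` (Markov property, file 45) and every-start mixing for `H`
  rw [integral_mul_comp_add_eq_transition β' κ hreal x hW hU0 hU s t hF hF1 hG hG1]
  exact h κ hreal _ hHm hHb s x

/-! ## §3. All finite-dimensional distributions converge to those of the stationary chain -/

/-- ★★★ **CONVERGENCE TO STATIONARITY IN FINITE-DIMENSIONAL DISTRIBUTIONS.**  There are `C, c > 0` (depending on `L, β'`) such that for every
realising kernel family `κ`, EVERY strong solution `U` from a deterministic start on ANY space, every waiting time `s` and every list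
`[(t₁,f₁),…,(t_n,f_n)]` of time increments and measurable observables with `|fᵢ| ≤ 1`:
`|E[f₁(U_(s+t₁))·f₂(U_(s+t₁+t₂))⋯f_n(U_(s+t₁+⋯+t_n))] − ∫ (K_(t₁)f₁⋯K_(t_n)f_n 1) dμ_(β')| ≤ C·e^(−cs)` — uniformly over the observables, i.e. each
finite-dimensional marginal of the shifted process `U_(s+·)` is `Ce^(−cs)`-close in total variation to that of the stationary chain
`μ_(β') ⊗ κ_(t₁) ⊗ ⋯ ⊗ κ_(t_n)`. [folklore] -/
theorem abs_foldr_comp_sub_stationary_le_exp (L : ℕ) [NeZero L] (β' : ℝ) :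
    ∃ C c : ℝ, 0 < C ∧ 0 < c ∧
      ∀ (κ : ℝ≥0 → Kernel (GaugeConfig 3 L (Matrix.specialUnitaryGroup (Fin 2) ℂ))
          (GaugeConfig 3 L (Matrix.specialUnitaryGroup (Fin 2) ℂ))) [∀ t, IsMarkovKernel (κ t)],
        (∀ (t : ℝ≥0) (x : GaugeConfig 3 L (Matrix.specialUnitaryGroup (Fin 2) ℂ))
          (Ω : Type) [MeasurableSpace Ω] (P : Measure Ω) [IsProbabilityMeasure P]
          (W : ℝ≥0 → Ω → (Edge 3 L × NoiseIdx 2 → ℝ)) (hW : IsFlatBrownian W P)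
          (U : ℝ≥0 → Ω → GaugeConfig 3 L (Matrix.specialUnitaryGroup (Fin 2) ℂ)),
          (∀ ω, U 0 ω = x) →
          (latticeLangevinDynamics (fundamentalLatticeRep 2) β').IsSolution (fundamentalRep (Fin 2))
            hW.natFiltration P W U →
          κ t x = P.map (U t)) →
        ∀ (x : GaugeConfig 3 L (Matrix.specialUnitaryGroup (Fin 2) ℂ))
          (Ω : Type) [MeasurableSpace Ω] (P : Measure Ω) [IsProbabilityMeasure P]
          (W : ℝ≥0 → Ω → (Edge 3 L × NoiseIdx 2 → ℝ)) (hW : IsFlatBrownian W P)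
          (U : ℝ≥0 → Ω → GaugeConfig 3 L (Matrix.specialUnitaryGroup (Fin 2) ℂ)),
          (∀ ω, U 0 ω = x) →
          (latticeLangevinDynamics (fundamentalLatticeRep 2) β').IsSolution (fundamentalRep (Fin 2)) hW.natFiltration P W U →
          ∀ (s : ℝ≥0) (l : List (ℝ≥0 × (GaugeConfig 3 L (Matrix.specialUnitaryGroup (Fin 2) ℂ) → ℝ))),
            (∀ p ∈ l, Measurable p.2) → (∀ p ∈ l, ∀ z, |p.2 z| ≤ 1) →
            |(∫ ω, (l.foldr (fun p acc => fun u => p.2 (U (u + p.1) ω) * acc (u + p.1)) (fun _ : ℝ≥0 => (1 : ℝ))) s ∂P) -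
                ∫ y, (l.foldr (fun p acc => fun y => ∫ z, p.2 z * acc z ∂(κ p.1 y))
                  (fun _ : GaugeConfig 3 L (Matrix.specialUnitaryGroup (Fin 2) ℂ) => (1 : ℝ))) y
                  ∂(wilsonMeasure (d := 3) (L := L) (fundamentalRep (Fin 2)) β')| ≤ C * Real.exp (-c * s) := by
  classical
  obtain ⟨C, c, hC, hc, h⟩ := abs_transition_sub_wilson_le_exp L β'
  refine ⟨C, c, hC, hc, fun κ _ hreal x Ω _ P _ W hW U hU0 hU s l hm hb => ?_⟩
  have hmU : ∀ u : ℝ≥0, Measurable (U u) := fun u => (hU.adapted u).mono (hW.natFiltration.le u) le_rfl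
  -- the finite-dimensional Markov property with `Z ≡ 1`
  have hM := integral_mul_foldr_comp_eq_integral_mul_foldr_transition β' κ hreal x hW hU0 hU l hm
    (fun p hp => ⟨1, hb p hp⟩) s (measurable_const (a := (1 : ℝ))) (fun _ => le_rfl)
  simp only [one_mul] at hM
  rw [hM]
  -- `E[K_l(U_s)] = ∫ K_l dκ_s(x)`
  have hKm : Measurable (l.foldr (fun p acc => fun y => ∫ z, p.2 z * acc z ∂(κ p.1 y))
      (fun _ : GaugeConfig 3 L (Matrix.specialUnitaryGroup (Fin 2) ℂ) => (1 : ℝ))) := measurable_foldr_transition κ l hm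
  have hKb := abs_foldr_transition_le_one κ l hb
  have hκs : κ s x = P.map (U s) := hreal s x Ω P W hW U hU0 hU
  have heq : ∫ ω, (l.foldr (fun p acc => fun y => ∫ z, p.2 z * acc z ∂(κ p.1 y))
      (fun _ : GaugeConfig 3 L (Matrix.specialUnitaryGroup (Fin 2) ℂ) => (1 : ℝ))) (U s ω) ∂P =
      ∫ y, (l.foldr (fun p acc => fun y => ∫ z, p.2 z * acc z ∂(κ p.1 y))
        (fun _ : GaugeConfig 3 L (Matrix.specialUnitaryGroup (Fin 2) ℂ) => (1 : ℝ))) y ∂(κ s x) := by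
    rw [hκs, integral_map (hmU s).aemeasurable hKm.aestronglyMeasurable]
  rw [heq]
  exact h κ hreal _ hKm hKb s x

/-! ## §4. The stationary finite-dimensional distributions are shift-invariant -/

/-- ★ **Shift-invariance of the stationary chain**: `∫ (∫ K_l dκ_u(y)) dμ_(β')(y) = ∫ K_l dμ_(β')` for every waiting time `u` — the stationary
finite-dimensional distributions `μ_(β') ⊗ κ_(t₁) ⊗ ⋯` do not depend on where the time origin is put (invariance of the Wilson–Gibbs measure under
THE kernels, SZZ Lemma 3.3 as proved in the tree). [cite: ShenZhuZhu2022, §3 Lemma 3.3 (p. 13)] -/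
theorem integral_wilson_transition_foldr_eq (β' : ℝ)
    (κ : ℝ≥0 → Kernel (GaugeConfig 3 L (Matrix.specialUnitaryGroup (Fin 2) ℂ))
      (GaugeConfig 3 L (Matrix.specialUnitaryGroup (Fin 2) ℂ))) [∀ t, IsMarkovKernel (κ t)]
    (hreal : ∀ (t : ℝ≥0) (x : GaugeConfig 3 L (Matrix.specialUnitaryGroup (Fin 2) ℂ))
        (Ω : Type) [MeasurableSpace Ω] (P : Measure Ω) [IsProbabilityMeasure P]
        (W : ℝ≥0 → Ω → (Edge 3 L × NoiseIdx 2 → ℝ)) (hW : IsFlatBrownian W P)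
        (U : ℝ≥0 → Ω → GaugeConfig 3 L (Matrix.specialUnitaryGroup (Fin 2) ℂ)),
        (∀ ω, U 0 ω = x) →
        (latticeLangevinDynamics (fundamentalLatticeRep 2) β').IsSolution (fundamentalRep (Fin 2))
          hW.natFiltration P W U →
        κ t x = P.map (U t))
    (u : ℝ≥0) (l : List (ℝ≥0 × (GaugeConfig 3 L (Matrix.specialUnitaryGroup (Fin 2) ℂ) → ℝ)))
    (hm : ∀ p ∈ l, Measurable p.2) (hb : ∀ p ∈ l, ∃ C : ℝ, ∀ z, |p.2 z| ≤ C) :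
    ∫ y, (∫ z, (l.foldr (fun p acc => fun y => ∫ z, p.2 z * acc z ∂(κ p.1 y))
        (fun _ : GaugeConfig 3 L (Matrix.specialUnitaryGroup (Fin 2) ℂ) => (1 : ℝ))) z ∂(κ u y))
        ∂(wilsonMeasure (d := 3) (L := L) (fundamentalRep (Fin 2)) β') =
      ∫ y, (l.foldr (fun p acc => fun y => ∫ z, p.2 z * acc z ∂(κ p.1 y))
        (fun _ : GaugeConfig 3 L (Matrix.specialUnitaryGroup (Fin 2) ℂ) => (1 : ℝ))) y
        ∂(wilsonMeasure (d := 3) (L := L) (fundamentalRep (Fin 2)) β') :=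
  integral_transitionKernel_integral_eq_wilson (L := L) β' κ hreal u (measurable_foldr_transition κ l hm)
    (exists_abs_foldr_transition_le κ l hb)

/-- **The stationary two-time correlation does not depend on the time origin**: `∫ κ_u(F·κ_tG) dμ_(β') = ∫ F·κ_tG dμ_(β')`. [folklore] -/
theorem integral_wilson_transition_mul_transition_eq (β' : ℝ)
    (κ : ℝ≥0 → Kernel (GaugeConfig 3 L (Matrix.specialUnitaryGroup (Fin 2) ℂ))
      (GaugeConfig 3 L (Matrix.specialUnitaryGroup (Fin 2) ℂ))) [∀ t, IsMarkovKernel (κ t)]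
    (hreal : ∀ (t : ℝ≥0) (x : GaugeConfig 3 L (Matrix.specialUnitaryGroup (Fin 2) ℂ))
        (Ω : Type) [MeasurableSpace Ω] (P : Measure Ω) [IsProbabilityMeasure P]
        (W : ℝ≥0 → Ω → (Edge 3 L × NoiseIdx 2 → ℝ)) (hW : IsFlatBrownian W P)
        (U : ℝ≥0 → Ω → GaugeConfig 3 L (Matrix.specialUnitaryGroup (Fin 2) ℂ)),
        (∀ ω, U 0 ω = x) →
        (latticeLangevinDynamics (fundamentalLatticeRep 2) β').IsSolution (fundamentalRep (Fin 2))
          hW.natFiltration P W U →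
        κ t x = P.map (U t))
    (u t : ℝ≥0) {F G : GaugeConfig 3 L (Matrix.specialUnitaryGroup (Fin 2) ℂ) → ℝ}
    (hF : Measurable F) {CF : ℝ} (hFb : ∀ z, |F z| ≤ CF) (hG : Measurable G) {CG : ℝ} (hGb : ∀ z, |G z| ≤ CG) :
    ∫ y, (∫ z, F z * (∫ w, G w ∂(κ t z)) ∂(κ u y)) ∂(wilsonMeasure (d := 3) (L := L) (fundamentalRep (Fin 2)) β') =
      ∫ y, F y * (∫ w, G w ∂(κ t y)) ∂(wilsonMeasure (d := 3) (L := L) (fundamentalRep (Fin 2)) β') := by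
  have hκGm : Measurable fun y => ∫ w, G w ∂(κ t y) := (hG.stronglyMeasurable.integral_kernel (κ := κ t)).measurable
  have hκGb : ∀ y, |∫ w, G w ∂(κ t y)| ≤ CG := fun y => by
    have hh := norm_integral_le_of_norm_le_const (μ := κ t y) (f := G) (C := CG)
      (Eventually.of_forall fun z => by simpa [Real.norm_eq_abs] using hGb z)
    simpa [Real.norm_eq_abs] using hh
  refine integral_transitionKernel_integral_eq_wilson (L := L) β' κ hreal u (hF.mul hκGm) ⟨CF * CG, fun y => ?_⟩
  rw [abs_mul]
  exact mul_le_mul (hFb y) (hκGb y) (abs_nonneg _) ((abs_nonneg _).trans (hFb y))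

end Summit.QuantumFields.YangMills.Theorems.ColdStartUniversality

end
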